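import Mathlib
import Summits.Ventures.HodgeRepro2.T5SmoothDualRep
import Summits.Ventures.HodgeRepro2.T5HeckeDoubleCoset

/-!
# Hecke operators on the smooth dual: `⟨T_g • l, v⟩ = #(KgK/K) · ⟨l, π(g⁻¹) v⟩`

Blind cell `pub-hodge-repro2`, seat p8 (gen 8), Tier-5 kernel support.  `T5HeckeMatrixCoefficient`
(T5-63) records `⟨l, T_g • v⟩ = #(KgK/K) · ⟨l, π(g) v⟩` for the double-coset operator acting on
`π^K`.  On the smooth dual `π̃ = smoothDualRep ρ` (T5-59) the same operator acts through the INVERSE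
double coset:

* `apply_smoothDualRep_apply` — `⟨π̃(x) l, v⟩ = ⟨l, π(x⁻¹) v⟩` (the contragredient action);
* `smoothDualRep_orbitMap_apply_eq` — for `l ∈ (π̃)^K`, `v ∈ π^K`, `x ↦ ⟨π̃(x) l, v⟩` is constant on `KgK`;
* `heckeSMul_doubleCosetOp_smoothDualRep_apply` — `⟨T_g • l, v⟩ = #(KgK/K) · ⟨l, π(g⁻¹) v⟩`;
* `heckeOp_smoothDualRep_apply` — `⟨e_K π̃(g) e_K l, v⟩ = ⟨l, π(g⁻¹) v⟩` (characteristic `0`, `π̃`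
  `K`-finite).

In the record: the left / right conventions for the Hecke action on a representation and on its
contragredient differ by `g ↦ g⁻¹` on the double cosets — this is the kernel form of that sentence,
without the anti-involution `f ↦ f^∨` of the convolution algebra (which stays prose).

README §8(d): uses an L-value-free non-vanishing device: NO.
-/

namespace Summit.Ventures.HodgeRepro2.T5HeckeDualMatrixCoefficient

noncomputable section

open Summit.Ventures.HodgeRepro2.LevelPositivity
open Summit.Ventures.HodgeRepro2.T5LevelIdempotent
open Summit.Ventures.HodgeRepro2.T5HeckeOperator
open Summit.Ventures.HodgeRepro2.T5HeckePermutationModule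
open Summit.Ventures.HodgeRepro2.T5HeckeDoubleCoset
open Summit.Ventures.HodgeRepro2.T5SmoothDual
open Summit.Ventures.HodgeRepro2.T5SmoothDualRep
open Summit.Ventures.HodgeRepro2.T5SmoothDualRep.SmoothDualSpace
open MulAction

variable {G : Type*} [Group G] [TopologicalSpace G] [IsTopologicalGroup G]
  {k : Type*} [Field k] {V : Type*} [AddCommGroup V] [Module k V]
  (ρ : Representation k G V) {K : Subgroup G}

/-- The contragredient action: `⟨π̃(x) l, v⟩ = ⟨l, π(x⁻¹) v⟩`. -/
theorem apply_smoothDualRep_apply (x : G) (l : SmoothDualSpace ρ) (v : V) :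
    ((smoothDualRep ρ x l).val : Module.Dual k V) v = (l.val : Module.Dual k V) (ρ x⁻¹ v) := by
  rw [coe_smoothDualRep_val, Representation.dual_apply, Module.Dual.transpose_apply,
    LinearMap.comp_apply]

/-- A `K`-fixed `l ∈ π̃` is insensitive to `K` on the right of the argument: `⟨l, π(κ) u⟩ = ⟨l, u⟩`. -/
theorem apply_rep_eq_of_mem_invariants {l : SmoothDualSpace ρ}
    (hl : l ∈ invariants (smoothDualRep ρ) K) {κ : G} (hκ : κ ∈ K) (u : V) :
    (l.val : Module.Dual k V) (ρ κ u) = (l.val : Module.Dual k V) u := by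
  have h := mem_invariants_iff.mp hl κ⁻¹ (inv_mem hκ)
  have h' := congrArg (fun b : SmoothDualSpace ρ => (b.val : Module.Dual k V) u) h
  simp only [apply_smoothDualRep_apply, inv_inv] at h'
  exact h'

/-- For `l ∈ (π̃)^K` and `v ∈ π^K`, `x ↦ ⟨π̃(x) l, v⟩` is constant on the `K`-orbit of `gK`. -/
theorem smoothDualRep_orbitMap_apply_eq {l : SmoothDualSpace ρ}
    (hl : l ∈ invariants (smoothDualRep ρ) K) {v : V} (hv : v ∈ invariants ρ K) (g : G)
    {x : G ⧸ K} (hx : x ∈ orbit K (g : G ⧸ K)) :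
    ((orbitMap (smoothDualRep ρ) l hl x).val : Module.Dual k V) v =
      (l.val : Module.Dual k V) (ρ g⁻¹ v) := by
  obtain ⟨κ, rfl⟩ := mem_orbit_iff.mp hx
  change ((orbitMap (smoothDualRep ρ) l hl ((((κ : G) * g : G)) : G ⧸ K)).val :
    Module.Dual k V) v = _
  rw [orbitMap_mk, apply_smoothDualRep_apply, mul_inv_rev, map_mul, Module.End.mul_apply,
    mem_invariants_iff.mp hv _ (inv_mem κ.2)]

/-- `⟨T_g • l, v⟩ = #(KgK/K) · ⟨l, π(g⁻¹) v⟩` for `l ∈ (π̃)^K`, `v ∈ π^K`. -/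
theorem heckeSMul_doubleCosetOp_smoothDualRep_apply (g : G) [Finite (orbit K (g : G ⧸ K))]
    (l : invariants (smoothDualRep ρ) K) {v : V} (hv : v ∈ invariants ρ K) :
    ((heckeSMul (smoothDualRep ρ) (doubleCosetOp k K g) l).1.val : Module.Dual k V) v =
      ((orbit K (g : G ⧸ K)).ncard : k) * (l.1.val : Module.Dual k V) (ρ g⁻¹ v) := by
  classical
  have h := heckeSMul_doubleCosetOp (smoothDualRep ρ) g l
  have h' := congrArg (fun b : SmoothDualSpace ρ => (b.val : Module.Dual k V) v) h
  rw [h', finsum_mem_eq_finite_toFinset_sum _ (Set.toFinite _)]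
  have hsum : ∀ s : Finset (G ⧸ K),
      (((∑ x ∈ s, orbitMap (smoothDualRep ρ) l.1 l.2 x).val : Module.Dual k V)) v =
        ∑ x ∈ s, ((orbitMap (smoothDualRep ρ) l.1 l.2 x).val : Module.Dual k V) v := by
    intro s
    induction s using Finset.induction_on with
    | empty => simp
    | insert a s ha ih => rw [Finset.sum_insert ha, Finset.sum_insert ha, val_add, Submodule.coe_add,
        LinearMap.add_apply, ih]
  rw [hsum, Finset.sum_congr rfl fun x hx => smoothDualRep_orbitMap_apply_eq ρ l.2 hv g
    ((Set.Finite.mem_toFinset _).mp hx), Finset.sum_const,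
    Set.ncard_eq_toFinset_card _ (Set.toFinite _), nsmul_eq_mul]

/-- `⟨e_K π̃(g) e_K l, v⟩ = ⟨l, π(g⁻¹) v⟩` for `l ∈ (π̃)^K`, `v ∈ π^K` (characteristic `0`, `π̃`
`K`-finite, `KgK/K` finite). -/
theorem heckeOp_smoothDualRep_apply [CharZero k] (hK : KFinite (smoothDualRep ρ) K) (g : G)
    [Finite (orbit K (g : G ⧸ K))] (l : invariants (smoothDualRep ρ) K) {v : V}
    (hv : v ∈ invariants ρ K) :
    ((heckeOp (smoothDualRep ρ) hK g l).1.val : Module.Dual k V) v =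
      (l.1.val : Module.Dual k V) (ρ g⁻¹ v) := by
  have hn : ((orbit K (g : G ⧸ K)).ncard : k) ≠ 0 := by
    exact_mod_cast ((Set.ncard_pos (Set.toFinite _)).mpr ⟨_, mem_orbit_self _⟩).ne'
  have h := heckeOp_eq_inv_ncard_smul (smoothDualRep ρ) g hK l
  have h' := congrArg (fun b : invariants (smoothDualRep ρ) K => ((b.1.val : Module.Dual k V)) v) h
  simp only [Submodule.coe_smul, val_smul, LinearMap.smul_apply, smul_eq_mul] at h'
  rw [h', heckeSMul_doubleCosetOp_smoothDualRep_apply ρ g l hv, ← mul_assoc, inv_mul_cancel₀ hn,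
    one_mul]

end

end Summit.Ventures.HodgeRepro2.T5HeckeDualMatrixCoefficient
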